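import Literature.AnabelianGeometry.EtaleTheta.Discharge.Sec4NonVacuityTowerLaws
import Literature.AnabelianGeometry.EtaleTheta.Discharge.Sec4NonVacuityCoveringThm44
import HarnessLib

/-!
# [EtTh] §4 over the GENUINE Kummer tower: Prop 4.2 (i)–(iv), Prop 4.3 (ii)(iii) and Thm 4.4 (i)–(iv) hold
# SIMULTANEOUSLY at `ToyTower` — the whole typed §4 picture at a setting with deck transformations
# (consistency witness, part 12 — conclusion)

S. Mochizuki, *The étale theta function and its Frobenioid-theoretic manifestations*, Publ. RIMS **45**
(2009) [MochizukiEtTh2009], §4: Prop 4.2 p.88, Prop 4.3 pp.90–91, Thm 4.4 pp.93–95 (PDF); [FrdI] Thm 5.2 (ii).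

CONSISTENCY WITNESS, TOY — PROOF-ONLY (no definition, no named fact, no instance, no `sorry`); conclusion of the
`ToyTower` programme (`Sec4NonVacuityTower.lean` p438749 — the genuine tower `Base` of covers `X_N` of `𝔾_m/ℂ`
with deck transformations `Aut(X_N) = ℤ/N`, `Φ = ℚ_{≥0}`, `B = ℂˣ × t^ℤ` with the twisted pull-back;
`Sec4NonVacuityTowerSetting.lean` p439046 — `Π^tp_X ↠ ℤ ↠ ℤ/N = Aut(X_N)` from the R78 χ-model, `A_⊙ = (X_1, 0)`,
`μ_N`-saturation; `Sec4NonVacuityTowerLaws.lean` — `B` a monoid on `D`, `C` a Frobenioid, roots only upstairs, the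
floor laws, Prop 4.2 (iii)∧(iv)).  Proved here, at `ToyTower.biKummerSetting p`:

* `ToyTower.prop42_i_and_ii`, `ToyTower.prop43_ii`, `ToyTower.prop43_iii` — Prop 4.2 (i)(ii) (abc-iut-L6-t12's
  `prop42_i_mkOfModel` / `prop42_ii_mkOfModel`), Prop 4.3 (ii)(iii) (`prop43_ii_of`, `prop43_iii_mkOfModel`);
* `ToyTower.hodot_eq_top` — `H_⊙ = Ker(Π^tp_X ↠ Aut(X_1)) = Π^tp_X` (`Aut(X_1) = ℤ/1` trivial), hence open;
* `ToyTower.thm44_id` — **Thm 4.4 (i)–(iv) FIRE for the identity self-equivalence** `Ψ = Ψ^bs = 𝟭` (an inhabitant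
  of abc-iut-L2-t3's `Thm44Hyp` built inline: `D = D₀[X_1]`, `H_⊙ = Π^tp_X` open) and `ψ = id`: the cell's closers
  `thm44_i_of_inputs` ("`C₂` is a Frobenioid" REAL — here WITH INTEGRAL EXPONENTS), `thm44_ii_of_subnodes`,
  `thm44_iii_of_inputs`, `thm44_iv_of_prop43_ii` all apply; the Galois-compatibility input T44-L09c is now about
  NON-TRIVIAL groups `H_A^bs = ℤ/N` (transport along `𝟭` is the identity of `Aut(X_N)`);
* `ToyTower.sec4_picture_tower` — **at ONE explicit `BiKummerSetting` whose base is the genuine Kummer tower: `C` IS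
  a Frobenioid with integral exponents, the uniformiser has NO square root downstairs but one upstairs, every
  `Π^tp_X ↠ Aut(X_N) ≅ ℤ/N` is onto, and the typed Prop 4.2 (i)(ii)(iii)(iv), Prop 4.3 (ii)(iii), Thm 4.4 (i)–(iv)
  hold SIMULTANEOUSLY.**  Compare `ToyCov.sec4_picture_with_roots` (p428819: the same list at the COLLAPSED tower,
  divisible exponents, trivial Galois) and `Toy.not_prop42_iii` (p422428).

HONEST LIMITS: a toy (𝔾_m, not a Tate curve; trivial [FrdI] vocabularies; `(N,H)`-slot `True`; the Galois datum is
the §1 root model's, acting through `Π^tp_X ↠ ℤ`; Thm 4.4 only for `Ψ = 𝟭`); consistency ≠ faithfulness; typed ≠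
proved.  Nothing here bears on, or takes a side on, [IUTchIII] Cor. 3.12.
-/

noncomputable section

namespace Literature.AnabelianGeometry.EtaleTheta

open CategoryTheory Opposite Literature.AlgebraicGeometry.Frobenioids
open scoped NNRat

namespace ToyTower

open Base

variable (p : ℕ) [Fact p.Prime]

/-! ## Prop 4.2 (i)(ii), Prop 4.3 (ii)(iii) at the tower -/

/-- **Prop 4.2 (i) and (ii) HOLD at the tower** (abc-iut-L6-t12's `prop42_i_mkOfModel`, `prop42_ii_mkOfModel` with
`hDS := Toy.coprime_cancel`, `hDSι := ToyTower.coprime_pull`). [cite: MochizukiEtTh2009, Prop 4.2 p.88] -/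
theorem prop42_i_and_ii : (ToyTower.biKummerSetting p).Prop42_i ∧ (ToyTower.biKummerSetting p).Prop42_ii :=
  ⟨BiKummerSetting.prop42_i_mkOfModel (ToyTower.temperedGroup p) ToyTower.temperedFrobenioid
    ToyTower.temperedFrobenioid_monoidType ToyTower.temperedFrobenioid_isPerfect ToyTower.realified.isUnit_BΛ
    (fun {A} a b => ∀ x : ToyTower.temperedFrobenioid.Φ.carrier A, x ∣ a → x ∣ b → x = 1) (fun _ => True)
    (ToyTower.galoisSurj p) (ToyTower.galoisSurj_surjective p) (fun _ _ _ => True)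
    (fun {_ _} G α₂ α₁ => ToyTower.temperedFrobenioid.ArisesFromBaseFrobeniusPair G α₂ α₁) ToyTower.Aodot
    ToyTower.isFrobeniusTrivial_Aodot trivial ToyTower.divisorMonoid_isDivisorial
    (fun h h' e => Toy.coprime_cancel h h' e),
  BiKummerSetting.prop42_ii_mkOfModel (ToyTower.temperedGroup p) ToyTower.temperedFrobenioid
    ToyTower.temperedFrobenioid_monoidType ToyTower.temperedFrobenioid_isPerfect ToyTower.realified.isUnit_BΛ
    (fun {A} a b => ∀ x : ToyTower.temperedFrobenioid.Φ.carrier A, x ∣ a → x ∣ b → x = 1) (fun _ => True)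
    (ToyTower.galoisSurj p) (ToyTower.galoisSurj_surjective p) (fun _ _ _ => True)
    (fun {_ _} G α₂ α₁ => ToyTower.temperedFrobenioid.ArisesFromBaseFrobeniusPair G α₂ α₁) ToyTower.Aodot
    ToyTower.isFrobeniusTrivial_Aodot trivial ToyTower.divisorMonoid_isDivisorial
    (fun h h' e => Toy.coprime_cancel h h' e) (fun e _ _ _ h y hya hyb => ToyTower.coprime_pull e h y hya hyb)⟩

/-- **Prop 4.3 (ii) HOLDS at the tower** (`prop43_ii_of`). [cite: MochizukiEtTh2009, Prop 4.3 p.90] -/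
theorem prop43_ii :
    (ToyTower.biKummerSetting p).Prop43_ii fun {_ _} φ => ToyTower.temperedFrobenioid.pullFracModel φ :=
  (ToyTower.biKummerSetting p).prop43_ii_of ToyTower.divisorMonoid_isDivisorial ToyTower.ratFnFunctor_isGroupLike
    (fun {_ _} φ => ToyTower.temperedFrobenioid.pullFracModel φ)

/-- **Prop 4.3 (iii) HOLDS at the tower** (`prop43_iii_mkOfModel`). [cite: MochizukiEtTh2009, Prop 4.3 p.91] -/
theorem prop43_iii :
    (ToyTower.biKummerSetting p).Prop43_iii fun {_ _} φ => ToyTower.temperedFrobenioid.pullFracModel φ :=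
  BiKummerSetting.prop43_iii_mkOfModel (ToyTower.temperedGroup p) ToyTower.temperedFrobenioid
    ToyTower.temperedFrobenioid_monoidType ToyTower.temperedFrobenioid_isPerfect ToyTower.realified.isUnit_BΛ
    (fun {A} a b => ∀ x : ToyTower.temperedFrobenioid.Φ.carrier A, x ∣ a → x ∣ b → x = 1) (fun _ => True)
    (ToyTower.galoisSurj p) (ToyTower.galoisSurj_surjective p) (fun _ _ _ => True)
    (fun {_ _} G α₂ α₁ => ToyTower.temperedFrobenioid.ArisesFromBaseFrobeniusPair G α₂ α₁) ToyTower.Aodot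
    ToyTower.isFrobeniusTrivial_Aodot trivial ToyTower.divisorMonoid_isDivisorial
    (fun {_ _} φ => ToyTower.temperedFrobenioid.pullFracModel φ)

/-! ## Thm 4.4 (i)–(iv) fire for the identity self-equivalence -/

/-- Cast along the identity divisibility is the identity. [folklore] -/
private theorem castHom_self_apply'' (B : ToyTower.Base) (x : ZMod B.lvl) :
    ZMod.castHom (dvd_rfl : (B.lvl : ℕ) ∣ B.lvl) (ZMod B.lvl) x = x :=
  RingHom.congr_fun (RingHom.ext_zmod (ZMod.castHom dvd_rfl (ZMod B.lvl)) (RingHom.id _)) x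

/-- Conjugating an endomorphism of `X_N` by a deck transformation does not change it (`ℤ/N` is abelian).
[cite: MochizukiEtTh2009, Def 3.3 p.73] -/
theorem conj_shift {A : ToyTower.Base} (e : A ≅ A) (f : A ⟶ A) : (e.inv ≫ f ≫ e.hom).shift = f.shift := by
  have h0 : e.inv.shift + e.hom.shift = 0 := by
    have h := congrArg Base.Hom.shift e.inv_hom_id
    rwa [Base.comp_shift, castHom_self_apply'', Base.id_shift] at h
  rw [Base.comp_shift, Base.comp_shift, castHom_self_apply'', castHom_self_apply'', add_left_comm, h0, add_zero]

/-- `Aut(X_1) = ℤ/1` is trivial. [cite: MochizukiEtTh2009, Def 4.1 p.86] -/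
theorem subsingleton_aut_one : Subsingleton (Aut ((⟨1⟩ : ToyTower.Base))) := by
  haveI : Subsingleton (ZMod ((⟨1⟩ : ToyTower.Base).lvl)) := by
    change Subsingleton (ZMod 1)
    infer_instance
  exact ⟨fun σ τ => by rw [eq_shiftIso σ, eq_shiftIso τ, Subsingleton.elim σ.hom.shift τ.hom.shift]⟩

/-- **`H_⊙ = Π^tp_X`**: the Galois surjection at `A_⊙^bs = X_1` is trivial (`Aut(X_1) = 1`), so its kernel is
everything. [cite: MochizukiEtTh2009, Def 4.1 p.86] -/
theorem hodot_eq_top : (ToyTower.biKummerSetting p).Hodot = ⊤ :=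
  eq_top_iff.2 fun _ _ => @Subsingleton.elim _ subsingleton_aut_one _ _

/-- **Thm 4.4 (i)–(iv) FIRE at the tower** for the identity self-equivalence `Ψ = Ψ^bs = 𝟭` (an inhabitant of
abc-iut-L2-t3's `Thm44Hyp`, built inline: `Φ` non-dilating = vocabulary slot, `D = D₀[X_1]`, `H_⊙ = Π^tp_X` open)
and `ψ = id`: `thm44_i_of_inputs` ("`C₂` is a Frobenioid" REAL, with integral exponents), `thm44_ii_of_subnodes`,
`thm44_iii_of_inputs`, `thm44_iv_of_prop43_ii`; the Galois compatibility T44-L09c concerns the NON-TRIVIAL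
`H_A^bs ⊆ Aut(X_N) = ℤ/N`. [cite: MochizukiEtTh2009, Thm 4.4 p.94] -/
theorem thm44_id :
    ∃ (h : BiKummerSetting.Thm44Hyp (ToyTower.biKummerSetting p) (ToyTower.biKummerSetting p))
      (ψ : ∀ A : (ToyTower.biKummerSetting p).C,
        (ToyTower.biKummerSetting p).biratUnits A ≃* (ToyTower.biKummerSetting p).biratUnits (h.Ψ.functor.obj A)),
      BiKummerSetting.Thm44_i h ∧ BiKummerSetting.Thm44_ii h ψ ∧ BiKummerSetting.Thm44_iii h ψ ∧
        BiKummerSetting.Thm44_iv h ψ (fun {_ _} φ => ToyTower.temperedFrobenioid.pullFracModel φ)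
          (fun {_ _} φ => ToyTower.temperedFrobenioid.pullFracModel φ) := by
  let h : BiKummerSetting.Thm44Hyp (ToyTower.biKummerSetting p) (ToyTower.biKummerSetting p) :=
    { isNonDilating₁ := fun _ _ => trivial
      isNonDilating₂ := fun _ _ => trivial
      baseShape₁ := ⟨(inferInstance : (𝟭 ToyTower.Base).Full), (inferInstance : (𝟭 ToyTower.Base).Faithful), ⟨1⟩,
        fun Y => ⟨fun _ => ⟨toOne Y⟩, fun _ => ⟨Y, ⟨Iso.refl _⟩⟩⟩⟩
      baseShape₂ := ⟨(inferInstance : (𝟭 ToyTower.Base).Full), (inferInstance : (𝟭 ToyTower.Base).Faithful), ⟨1⟩,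
        fun Y => ⟨fun _ => ⟨toOne Y⟩, fun _ => ⟨Y, ⟨Iso.refl _⟩⟩⟩⟩
      isOpen_Hodot₁ := by rw [hodot_eq_top, Subgroup.coe_top]; exact isOpen_univ
      isOpen_Hodot₂ := by rw [hodot_eq_top, Subgroup.coe_top]; exact isOpen_univ
      Ψ := CategoryTheory.Equivalence.refl
      Ψbs := CategoryTheory.Equivalence.refl
      comm := (ToyTower.biKummerSetting p).base.rightUnitor ≪≫ (ToyTower.biKummerSetting p).base.leftUnitor.symm
      mapsAodot := ⟨Iso.refl _⟩ }
  have hPFS : h.PreservesFrobeniusStructure := ⟨fun _ _ _ => rfl, fun _ _ _ h => h, fun _ _ _ h => h, fun _ _ _ h => h⟩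
  have hHodot : h.HodotCompatible := ⟨ContinuousMulEquiv.refl _, Subgroup.map_id _⟩
  have hT : ∀ A : (ToyTower.biKummerSetting p).C, h.transportBaseAut A = MonoidHom.id _ := fun A => by
    refine MonoidHom.ext fun σ => Aut.ext ?_
    rw [BiKummerSetting.Thm44Hyp.transportBaseAut_hom]
    exact Base.hom_ext (conj_shift (h.cmp A) σ.hom)
  have hGal : h.GaloisCompatible := fun A hA => ⟨hA, by rw [hT A]; exact Subgroup.map_id _⟩
  have hBirat : h.BiratCompatible fun _ => MulEquiv.refl _ :=
    ⟨fun _ _ _ _ => rfl, fun _ _ _ _ _ _ _ _ => rfl, fun _ _ => rfl⟩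
  have hPDS : h.PreservesDisjointSupports := fun _ _ _ _ h => h
  have hPNH : h.PreservesNHSaturatedBsFld := fun _ _ _ _ _ => Iff.rfl
  exact ⟨h, fun _ => MulEquiv.refl _,
    h.thm44_i_of_inputs ToyTower.temperedFrobenioid_isFrobenioid hPFS hGal hHodot,
    h.thm44_ii_of_subnodes _ hPFS hBirat hPDS,
    h.thm44_iii_of_inputs _ hPFS (fun _ _ _ h => h) ToyTower.temperedFrobenioid_isFrobenioid hPNH,
    BiKummerSetting.thm44_iv_of_prop43_ii h (fun _ => MulEquiv.refl _)
      (fun {_ _} φ => ToyTower.temperedFrobenioid.pullFracModel φ)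
      (fun {_ _} φ => ToyTower.temperedFrobenioid.pullFracModel φ) (prop43_ii p)⟩

/-! ## The whole typed §4 picture at one setting over the genuine tower -/

/-- **The §4 picture over the GENUINE Kummer tower, at ONE explicit setting** `ToyTower.biKummerSetting p`: `C` IS
a Frobenioid (integral exponents, deck transformations); the uniformiser `t_1` has NO square root on `X_1` but one
on `X_2` (ERRATUM E2); every `Π^tp_X ↠ Aut(X_N)` is onto with `Aut(X_N) ≃ ℤ/N`; and the typed Prop 4.2 (i), (ii),
(iii), (iv), Prop 4.3 (ii), (iii) and Thm 4.4 (i)–(iv) (identity self-equivalence, `ψ = id`) hold there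
SIMULTANEOUSLY. [cite: MochizukiEtTh2009, Prop 4.2 p.88] -/
theorem sec4_picture_tower :
    PreFrobenioid.IsFrobenioid ToyTower.temperedFrobenioid.toElem ∧
      ((¬ ∃ g : ToyTower.temperedFrobenioid.ratFnFunctor.obj (op (⟨1⟩ : ToyTower.Base)),
          g ^ 2 = ToyTower.unif ⟨1⟩) ∧
        ∃ g : ToyTower.temperedFrobenioid.ratFnFunctor.obj (op (ToyTower.coverObj ⟨1⟩ 2)),
          g ^ 2 = pull ToyTower.temperedFrobenioid.ratFnFunctor (ToyTower.cover ⟨1⟩ 2) (ToyTower.unif ⟨1⟩)) ∧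
      (∀ A : ToyTower.Base, Function.Surjective (ToyTower.galoisSurj p A trivial) ∧ Nonempty (Aut A ≃ ZMod A.lvl)) ∧
      (ToyTower.biKummerSetting p).Prop42_i ∧ (ToyTower.biKummerSetting p).Prop42_ii ∧
      (ToyTower.biKummerSetting p).Prop42_iii (fun {_ _} φ x => ToyTower.temperedFrobenioid.pullFracModel φ x) ∧
      (ToyTower.biKummerSetting p).Prop42_iv (fun φ x => ToyTower.temperedFrobenioid.pullFracModel φ x) ∧
      ((ToyTower.biKummerSetting p).Prop43_ii fun {_ _} φ => ToyTower.temperedFrobenioid.pullFracModel φ) ∧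
      ((ToyTower.biKummerSetting p).Prop43_iii fun {_ _} φ => ToyTower.temperedFrobenioid.pullFracModel φ) ∧
      ∃ (h : BiKummerSetting.Thm44Hyp (ToyTower.biKummerSetting p) (ToyTower.biKummerSetting p))
        (ψ : ∀ A : (ToyTower.biKummerSetting p).C,
          (ToyTower.biKummerSetting p).biratUnits A ≃* (ToyTower.biKummerSetting p).biratUnits (h.Ψ.functor.obj A)),
        BiKummerSetting.Thm44_i h ∧ BiKummerSetting.Thm44_ii h ψ ∧ BiKummerSetting.Thm44_iii h ψ ∧
          BiKummerSetting.Thm44_iv h ψ (fun {_ _} φ => ToyTower.temperedFrobenioid.pullFracModel φ)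
            (fun {_ _} φ => ToyTower.temperedFrobenioid.pullFracModel φ) :=
  ⟨ToyTower.temperedFrobenioid_isFrobenioid, (ToyTower.roots_only_upstairs ⟨1⟩).2,
    fun A => ((ToyTower.nonempty_biKummerSetting_tower p).choose_spec.2 A), (prop42_i_and_ii p).1,
    (prop42_i_and_ii p).2, (ToyTower.laws_and_prop42_iii_iv p).2.2.1, (ToyTower.laws_and_prop42_iii_iv p).2.2.2,
    prop43_ii p, prop43_iii p, thm44_id p⟩

end ToyTower

end Literature.AnabelianGeometry.EtaleTheta

end
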